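import Literature.NumberTheory.EllipticCurves.SelmerFiniteProofs
import Literature.NumberTheory.EllipticCurves.SelmerCorankAssembly
import HarnessLib

/-!
# Finiteness of `Ш(E/K)[n]` (Silverman AEC Thm. X.4.2(b)): discharge of
# `WeierstrassCurve.finite_sha_torsionBy`

`Proofs` companion of `Literature/NumberTheory/EllipticCurves/Sha.lean`, discharging its named fact
`WeierstrassCurve.finite_sha_torsionBy` (Silverman, *The Arithmetic of Elliptic Curves*, 2nd ed.,
Thm. X.4.2(b): for an elliptic curve `E` over a number field `K` and `n ≠ 0`, the `n`-torsion
`Ш(E/K)[n]` of the Tate–Shafarevich group is finite).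

Silverman's proof: the exact sequence `0 → E(K)/nE(K) → S^{(n)}(E/K) → Ш(E/K)[n] → 0`
(X.4.2(a), from the Kummer sequence VIII.§2) and the finiteness of the Selmer group (X.4.2(b),
from Lemma X.4.3 = inflation–restriction + Prop. VIII.1.6, and Cor. X.4.4 = unramifiedness of
Selmer classes outside `S`, via the reduction step VIII.1.4). In the tree this is the chain

* `WeierstrassCurve.finite_selmerGroup_holds` (`SelmerFiniteProofs`: Thm. X.4.2(b) for the Selmer
  group, assembled from `Literature.NumberTheory.EllipticCurves.finite_h1Unramified_holds` — Lemma X.4.3, `H1UnramifiedFiniteProofs` —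
  and `selmerGroup_le_h1Unramified_holds` — Cor. X.4.4, from the local–global compatibility of
  inertia `exists_mem_inertia_apply_eq_holds` (`SelmerInertiaProofs`, Neukirch II (9.6)) and the
  reduction step `smul_localPoints_eq_of_mem_inertia_holds` (`GoodReductionInertia`,
  `SelmerFiniteProofs`));
* `WeierstrassCurve.finite_sha_torsionBy_of_finite_selmerGroup` (`SelmerCorankAssembly`:
  `Ш[n]` finite from `Sel^{(p)}` finite for all primes `p`, through the Kummer map
  `Sel^{(n)} → Ш[n]`, X.4.2(a), `SelmerImage`/`SelmerProofs`, and induction over `n`).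

## References

* [SilvermanAEC2009] J. H. Silverman, *The Arithmetic of Elliptic Curves*, 2nd ed., GTM 106,
  Springer 2009, doi:10.1007/978-0-387-09494-6: X.§4, Thm. 4.2 (a),(b), Lemma 4.3, Cor. 4.4
  (pp. 331–333; held PDF pp. 285–287); VIII.§1 Props. 1.4–1.6, VIII.§2 (Kummer sequence).
-/

noncomputable section

universe u

namespace WeierstrassCurve

open NumberField

variable {K : Type u} [Field K] [NumberField K] (W : WeierstrassCurve K)

/-- **Silverman AEC Thm. X.4.2(b): `Ш(E/K)[n]` is finite** for an elliptic curve `E` over a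
number field `K` and every `n ≠ 0` — the discharge of the named fact
`WeierstrassCurve.finite_sha_torsionBy` (`Sha.lean`): the finiteness of the Selmer groups
(`finite_selmerGroup_holds`, X.4.2(b) with Lemma X.4.3 and Cor. X.4.4) and the Kummer exact
sequence `Sel^{(n)}(E/K) ↠ Ш(E/K)[n]` (X.4.2(a), `finite_sha_torsionBy_of_finite_selmerGroup`).
[cite: SilvermanAEC2009, Thm. X.4.2(b)] -/
theorem finite_sha_torsionBy_holds : W.finite_sha_torsionBy :=
  W.finite_sha_torsionBy_of_finite_selmerGroup W.finite_selmerGroup_holds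

end WeierstrassCurve
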